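import Summits.HodgeConjecture.HodgeConjecture.Theorems.F0P3cStCharTSStField        -- ★ p851465 (this seat) S4b FILE D (brings ★ C StOneDim p851438, ★ B StLabels p851392, ★ A StChar p851315)
import Literature.NumberTheory.Rogawski1990.Ch12Sec5Inputs                           -- ★ the (S-𝔇) sockets `EllipticData.DetNotL2`, `IsL2`
import Mathlib.Topology.Algebra.Group.Matrix
import HarnessLib

/-!
# F0 · P3c · line LH6 «StCharTS» — «ST-PIN★»: THE FIELDS `stG`, `detG` OF THE §12.5 DATUM AS TOTAL FUNCTIONS OF `ψ ∈ Hom(Z, ℂ^*)`, COHERENTLY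
# («`JH(i_G(χ_St(ψ))) = {ψ∘det_G, St_G(ψ)}`», [Rogawski1990, §12.2 (1)]), WITH (ST-L2) AND (DET) PAID AT EVERY DATUM BUILT ON THEM (datum road, S4 pin, file E)

Cell `pub/hodgecm-mathlib`, crux H413 = `stmt-HodgeConjecture-24833` (lane `--supports … --as helper`), route HCCMUnconditional; seat F0P2-p06 (g17).
THEOREMS ONLY (no definition ∕ instance ∕ notation ∕ named fact ∕ `sorry`); ★-only imports.

WHAT.  The RUNG-0 honesty analysis of the map owner (LH6-p01 (g4), MAP v4 §3) asks that every field READ by a named conjunct of (S-𝔇) be PINNED to print's object.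
The fields `stG`, `detG : (Z(G) →* ℂˣ) → IrrClass G` are read by (ST-L2), (DET) and by `IsEllipticPair` (kind 2: `{St_G(ψ), ψ∘det_G}`) inside Prop. 12.6.1 (b)(c) ∕ the
elliptic classification.  This file produces them as TOTAL FUNCTIONS, coherently: a continuous scalar embedding `ι : E¹_v →* Z(G)` (`ι z = z·1`), the determinant
`det_Z := ι ∘ det : G →* Z(G)` (`det_Z g = (det g)·1`, the clause of ★ «DET-FIELD★» verbatim), and for every CONTINUOUS `ψ : Z(G) →* ℂˣ` the LABELLED PAIR of the
case-(1) principal series `i_G(χ_St(ψ ∘ ι))` (★ B4 `stLabels` with ★ C's reducibility): `detG ψ = ⟦ℂ_{ψ ∘ det_Z}⟧` (the one-dimensional constituent, exponent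
`χ_St`, NOT square-integrable) and `stG ψ = St_G(ψ)` (the other constituent, exponent `wχ_St`, square-integrable — Casselman ★ N5), `{stG ψ, detG ψ} = JH(i_G(χ_St(ψ∘ι)))`,
`stG ψ ≠ detG ψ`; at discontinuous `ψ` both are a harmless junk class (only continuous `ψ` are ever read).  At every datum `𝔇` with `𝔇.stG = stG`, `𝔇.detG = detG`,
`𝔇.μGZ = μZ`: (ST-L2) and (DET) `DetNotL2` hold TOKEN FOR TOKEN.
HONEST LABEL: HC_CM is proved only modulo the 7 printed citations (2 remaining named inputs: hLiu418 = `stmt-HodgeConjecture-24832`, h413 =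
`stmt-HodgeConjecture-24833`) until rung 0 closes; this file closes no organ (count-neutral pin for the witness ∕ rung-0 skeleton).

## References
* [Rogawski1990] J. D. Rogawski, *Automorphic Representations of Unitary Groups in Three Variables*, Ann. of Math. Stud. 123 (1990): §4.9 p. 54 (`Z ≅ E¹`), §12.1 p. 172,
  §12.2 (1) p. 173, §12.6 Prop. 12.6.1 (b) p. 188.
* [Keys1984] D. Keys, *Principal series representations of special unitary groups over local fields*, Compositio Math. 51 (1984), §7 Theorem.
* [Casselman1995] W. Casselman, *Introduction to the theory of admissible representations of `p`-adic reductive groups* (1995), Thm 4.4.6.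
-/

set_option autoImplicit false
-- the mandated namespace has the single-problem summit's repeated segment (`HodgeConjecture.HodgeConjecture`)
set_option linter.dupNamespace false

noncomputable section

open NumberField IsDedekindDomain MeasureTheory Topology
open scoped Matrix MatrixGroups NNReal
open Literature.NumberTheory.Rogawski1990 Literature.NumberTheory.Automorphic Literature.NumberTheory.Automorphic.UnitaryGroup
open Literature.NumberTheory.Rogawski1990.Ch12Sec5

namespace Summit.HodgeConjecture.HodgeConjecture.Cruxes.H413.F0P3cStCharTSStPin

variable (L : Type) [Field L] [NumberField L] [IsCMField L] (v : HeightOneSpectrum (𝓞 ↥(maximalRealSubfield L)))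

/-! ## §1 The scalar embedding `ι : E¹_v →* Z(U(Φ₃)(L⁺_v))`, `z ↦ z·1` -/

/-- **The scalar embedding of `E¹_v` into the centre of `U(Φ₃)(L⁺_v)`**: a continuous hom `ι` with `ι z = z·1` (`σ(z) z = 1` makes `z·1` unitary, ★ `scalar_mem_unitaryGroupOfForm`;
scalars are central) — print's identification «`Z = E¹`» [§4.9 p. 54] read as a map (no definition introduced). [cite: Rogawski1990, §4.9 p. 54; §12.2 (1) p. 172]
[cite: Mok2014, §1 Notation p. 5] -/
theorem exists_scalarCenter :
    ∃ ι : ↥(normOneUnits (conjLocal L (IsCMField.complexConj L) v)) →* ↥(Subgroup.center (Gqs L v)), Continuous ι ∧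
      ∀ z : ↥(normOneUnits (conjLocal L (IsCMField.complexConj L) v)),
        ((ι z).val.val.val : Matrix (Fin 3) (Fin 3) (LocalRing L v)) = (((z : (LocalRing L v)ˣ) : LocalRing L v)) • (1 : Matrix (Fin 3) (Fin 3) (LocalRing L v)) := by
  let U : Subgroup (GL (Fin 3) (LocalRing L v)) := UnitaryGroup.local L (IsCMField.complexConj L) 3 (qsForm L) v
  let sc : (LocalRing L v)ˣ →* GL (Fin 3) (LocalRing L v) :=
    Units.map (Matrix.scalar (Fin 3) : LocalRing L v →+* Matrix (Fin 3) (Fin 3) (LocalRing L v)).toMonoidHom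
  let e : ↥(normOneUnits (conjLocal L (IsCMField.complexConj L) v)) →* GL (Fin 3) (LocalRing L v) :=
    sc.comp (normOneUnits (conjLocal L (IsCMField.complexConj L) v)).subtype
  have he_apply : ∀ z, e z = sc (z : (LocalRing L v)ˣ) := fun z => rfl
  have hsc_coe : ∀ u : (LocalRing L v)ˣ, ((sc u).val : Matrix (Fin 3) (Fin 3) (LocalRing L v)) =
      (u : LocalRing L v) • (1 : Matrix (Fin 3) (Fin 3) (LocalRing L v)) := fun u => by
    show Matrix.scalar (Fin 3) (u : LocalRing L v) = _
    rw [Matrix.scalar_apply, Matrix.smul_one_eq_diagonal]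
  have hmem : ∀ z, e z ∈ U := fun z => by
    rw [he_apply]
    exact scalar_mem_unitaryGroupOfForm _ _ _ ((UnitaryGroup.mem_normOneUnits_iff _).1 z.2)
  let eU : ↥(normOneUnits (conjLocal L (IsCMField.complexConj L) v)) →* ↥U := e.codRestrict U hmem
  have hcoe : ∀ z, ((eU z).val.val : Matrix (Fin 3) (Fin 3) (LocalRing L v)) =
      (((z : (LocalRing L v)ˣ) : LocalRing L v)) • (1 : Matrix (Fin 3) (Fin 3) (LocalRing L v)) := fun z => by
    show ((e z).val : Matrix (Fin 3) (Fin 3) (LocalRing L v)) = _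
    rw [he_apply, hsc_coe]
  have hcent : ∀ z, eU z ∈ Subgroup.center ↥U := by
    intro z
    rw [Subgroup.mem_center_iff]
    intro x
    refine Subtype.ext (Units.ext ?_)
    change (x.val.val : Matrix (Fin 3) (Fin 3) (LocalRing L v)) * (eU z).val.val = ((eU z).val.val : Matrix (Fin 3) (Fin 3) (LocalRing L v)) * x.val.val
    rw [hcoe, Matrix.mul_smul, Matrix.mul_one, Matrix.smul_mul, Matrix.one_mul]
  have hec : Continuous e := by
    refine (Continuous.units_map _ ?_).comp continuous_subtype_val
    show Continuous fun r : LocalRing L v => Matrix.scalar (Fin 3) r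
    simp only [Matrix.scalar_apply]
    exact (continuous_pi fun _ => continuous_id).matrix_diagonal
  exact ⟨eU.codRestrict _ hcent, (hec.subtype_mk _).subtype_mk _, fun z => hcoe z⟩

/-! ## §2 The pinned fields `stG`, `detG` (and `ι`, `det_Z`), with (ST-L2) and (DET) at every datum built on them -/

set_option synthInstance.maxHeartbeats 400000 in
set_option maxHeartbeats 16000000 in  -- the `Gqs L v`∕literal-carrier bookkeeping of ★ B4∕C∕D (same class as ★ `F0P3cStCharTSStLabels` (B4))
/-- **«ST-PIN★» — `stG`, `detG` AS TOTAL FUNCTIONS, COHERENT, WITH (ST-L2) AND (DET) PAID** (non-split `v`, any Haar `μZ` on `G ⧸ Z`).  There are a continuous scalar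
embedding `ι : E¹_v →* Z(G)` (`ι z = z·1`), a continuous `det_Z : G →* Z(G)` with `det_Z g = (det g)·1` (★ «DET-FIELD★»'s clause verbatim; `det_Z = ι ∘ det`), and
`detG stG : (Z(G) →* ℂˣ) → Irr(G)` such that for every CONTINUOUS `ψ`: `detG ψ = ⟦ℂ_{ψ ∘ det_Z}⟧` (★ `SmoothIrrep.ofChar`; ★ «DET-FIELD★»'s clause verbatim), `stG ψ ≠ detG ψ`,
the constituents of the case-(1) principal series `i_G(χ_St(ψ ∘ ι))` are EXACTLY `stG ψ` and `detG ψ`, `stG ψ` is square-integrable modulo the centre and `detG ψ` is not,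
with Jacquet data `r(detG ψ) ≅ χ_St(ψ∘ι)`, `r(stG ψ) ≅ wχ_St(ψ∘ι)` — print's «`JH(i_G(χ)) = {ψ∘det_G, St_G(ψ)}`» [§12.2 (1)] with both labels pinned (★ B4 `stLabels` at
`ψ∘ι`, ★ C `exists_subrepresentation_ne_bot_ne_top_stChar` ∕ `isConstituentOf_ofChar_stChar` ∕ `hasJacquetExponent_ofChar_stChar`, ★ D `mk_ofChar_ne_of_jacquet_weylStChar`);
AND at every §12.5 datum `𝔇` on `(U(Φ₃)(L⁺_v), H′)` with `𝔇.stG = stG`, `𝔇.detG = detG`, `𝔇.μGZ = μZ`: (ST-L2) `∀ ψ, Continuous ψ → 𝔇.IsL2 (𝔇.stG ψ)` and (DET) `𝔇.DetNotL2`,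
TOKEN FOR TOKEN. [cite: Rogawski1990, §12.1 p. 172; §12.2 (1) pp. 172–173; §12.6 Prop. 12.6.1 (b) p. 188] [cite: Keys1984, §7 Theorem] [cite: Casselman1995, Thm 4.4.6] -/
theorem exists_stDetFields (hns : ∀ w : PlacesOver L v, IsCMField.complexConj L • w.1 = w.1)
    [MeasurableSpace (Gqs L v ⧸ Subgroup.center (Gqs L v))] [BorelSpace (Gqs L v ⧸ Subgroup.center (Gqs L v))]
    (μZ : Measure (Gqs L v ⧸ Subgroup.center (Gqs L v))) [μZ.IsHaarMeasure] :
    ∃ (ι : ↥(normOneUnits (conjLocal L (IsCMField.complexConj L) v)) →* ↥(Subgroup.center (Gqs L v)))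
      (detZ : Gqs L v →* ↥(Subgroup.center (Gqs L v)))
      (detG stG : (↥(Subgroup.center (Gqs L v)) →* ℂˣ) → IrrClass (Gqs L v)),
      Continuous ι ∧ Continuous detZ ∧
      (∀ z : ↥(normOneUnits (conjLocal L (IsCMField.complexConj L) v)),
        ((ι z).val.val.val : Matrix (Fin 3) (Fin 3) (LocalRing L v)) = (((z : (LocalRing L v)ˣ) : LocalRing L v)) • (1 : Matrix (Fin 3) (Fin 3) (LocalRing L v))) ∧
      (∀ g : Gqs L v, ((detZ g).val.val.val : Matrix (Fin 3) (Fin 3) (LocalRing L v)) =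
        (g.val.val : Matrix (Fin 3) (Fin 3) (LocalRing L v)).det • (1 : Matrix (Fin 3) (Fin 3) (LocalRing L v))) ∧
      (∀ ψ : ↥(Subgroup.center (Gqs L v)) →* ℂˣ, Continuous ψ →
        (∃ hopen : IsOpen (((ψ.comp detZ).ker : Subgroup (Gqs L v)) : Set (Gqs L v)),
          detG ψ = IrrClass.mk (SmoothIrrep.ofChar (ψ.comp detZ) hopen)) ∧
        stG ψ ≠ detG ψ ∧
        (∀ c : IrrClass (Gqs L v),
          c.IsConstituentOf (cmPrincipalSeries L 3 v
            (cmTorusCharPair L v (halfModulusChar (LocalRing L v) * halfModulusChar (LocalRing L v))⁻¹ (ψ.comp ι))) ↔ (c = stG ψ ∨ c = detG ψ)) ∧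
        (stG ψ).IsSquareIntegrable μZ ∧ ¬ (detG ψ).IsSquareIntegrable μZ ∧
        (haveI := locallyCompactSpace_cmBorelU L 3 v
         ∃ r : SmoothIrrep (Gqs L v), IrrClass.mk r = detG ψ ∧
          Nonempty ((r.ρ.normalizedJacquet (cmBorelTriple L 3 v)).Equiv
            ((Representation.trivial ℂ ↥(torusU (conjLocal L (IsCMField.complexConj L) v) (cmLocalForm L 3 v)) ℂ).twist
              (cmTorusCharPair L v (halfModulusChar (LocalRing L v) * halfModulusChar (LocalRing L v))⁻¹ (ψ.comp ι))))) ∧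
        (haveI := locallyCompactSpace_cmBorelU L 3 v
         ∃ r : SmoothIrrep (Gqs L v), IrrClass.mk r = stG ψ ∧
          Nonempty ((r.ρ.normalizedJacquet (cmBorelTriple L 3 v)).Equiv
            ((Representation.trivial ℂ ↥(torusU (conjLocal L (IsCMField.complexConj L) v) (cmLocalForm L 3 v)) ℂ).twist
              (cmWeylTorusCharPair L v (halfModulusChar (LocalRing L v) * halfModulusChar (LocalRing L v))⁻¹ (ψ.comp ι)))))) ∧
      (∀ {H' : Type} [Group H'] [TopologicalSpace H'] [IsTopologicalGroup H'] [MeasurableSpace H']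
        [MeasurableSpace (Gqs L v)] [∀ γ : Gqs L v, MeasurableSpace (Gqs L v ⧸ Subgroup.centralizer ({γ} : Set (Gqs L v)))]
        (𝔇 : EllipticData (Gqs L v) H'), 𝔇.stG = stG → 𝔇.detG = detG → 𝔇.μGZ = μZ →
          (∀ ψ : ↥(Subgroup.center (Gqs L v)) →* ℂˣ, Continuous ψ → 𝔇.IsL2 (𝔇.stG ψ)) ∧ 𝔇.DetNotL2) := by
  classical
  haveI := locallyCompactSpace_cmBorelU L 3 v
  obtain ⟨ι, hιc, hιval⟩ := exists_scalarCenter L v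
  obtain ⟨d, hd, hdc⟩ := F0P3cStCharTSStOneDim.exists_detNormOne L v
  -- continuity of `ψ ∘ ι` and the open kernel of `ψ ∘ ι ∘ det`
  have hψE : ∀ ψ : ↥(Subgroup.center (Gqs L v)) →* ℂˣ, Continuous ψ → Continuous (ψ.comp ι) := fun ψ h => h.comp hιc
  -- (typed over the literal carrier `↥(unitaryGroupOfForm …)` = `Gqs L v` definitionally; `(ψ.comp ι).comp d = ψ.comp (ι.comp d)` by `rfl`)
  have hopen : ∀ ψ : ↥(Subgroup.center (Gqs L v)) →* ℂˣ, Continuous ψ →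
      IsOpen ((((ψ.comp ι).comp d).ker : Subgroup ↥(unitaryGroupOfForm (conjLocal L (IsCMField.complexConj L) v) (cmLocalForm L 3 v))) :
        Set ↥(unitaryGroupOfForm (conjLocal L (IsCMField.complexConj L) v) (cmLocalForm L 3 v))) := fun ψ h =>
    F0P3cStCharTSStOneDim.isOpen_ker_comp L v (ψ.comp ι) (hψE ψ h) d hdc
  have hone : IsOpen (((1 : Gqs L v →* ℂˣ).ker : Subgroup (Gqs L v)) : Set (Gqs L v)) := by
    rw [MonoidHom.ker_one, Subgroup.coe_top]
    exact isOpen_univ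
  -- the labelled pair of `i_G(χ_St(ψ∘ι))` (★ B4 with ★ C's `hred`)
  have hlab : ∀ ψ : ↥(Subgroup.center (Gqs L v)) →* ℂˣ, Continuous ψ → ∃ π₁ πSt : IrrClass (Gqs L v), π₁ ≠ πSt ∧
      (∀ c : IrrClass (Gqs L v),
          c.IsConstituentOf (cmPrincipalSeries L 3 v
            (cmTorusCharPair L v (halfModulusChar (LocalRing L v) * halfModulusChar (LocalRing L v))⁻¹ (ψ.comp ι))) ↔ (c = πSt ∨ c = π₁)) ∧
      πSt.IsSquareIntegrable μZ ∧ ¬ π₁.IsSquareIntegrable μZ ∧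
      (∃ r : SmoothIrrep (Gqs L v), IrrClass.mk r = π₁ ∧
        Nonempty ((r.ρ.normalizedJacquet (cmBorelTriple L 3 v)).Equiv
          ((Representation.trivial ℂ ↥(torusU (conjLocal L (IsCMField.complexConj L) v) (cmLocalForm L 3 v)) ℂ).twist
            (cmTorusCharPair L v (halfModulusChar (LocalRing L v) * halfModulusChar (LocalRing L v))⁻¹ (ψ.comp ι))))) ∧
      (∃ r : SmoothIrrep (Gqs L v), IrrClass.mk r = πSt ∧
        Nonempty ((r.ρ.normalizedJacquet (cmBorelTriple L 3 v)).Equiv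
          ((Representation.trivial ℂ ↥(torusU (conjLocal L (IsCMField.complexConj L) v) (cmLocalForm L 3 v)) ℂ).twist
            (cmWeylTorusCharPair L v (halfModulusChar (LocalRing L v) * halfModulusChar (LocalRing L v))⁻¹ (ψ.comp ι))))) :=
    fun ψ h => F0P3cStCharTSStLabels.stLabels L v hns μZ (ψ.comp ι) (Units.continuous_val.comp (hψE ψ h))
      (F0P3cStCharTSStOneDim.exists_subrepresentation_ne_bot_ne_top_stChar L v hns (ψ.comp ι) (hψE ψ h))
  -- THE FIELDS
  refine ⟨ι, ι.comp d,
    fun ψ => if h : Continuous ψ then IrrClass.mk (SmoothIrrep.ofChar (ψ.comp (ι.comp d)) (hopen ψ h)) else IrrClass.mk (SmoothIrrep.ofChar 1 hone),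
    fun ψ => if h : Continuous ψ then (hlab ψ h).choose_spec.choose else IrrClass.mk (SmoothIrrep.ofChar 1 hone),
    hιc, hιc.comp hdc, hιval, fun g => ?_, fun ψ hψ => ?_, ?_⟩
  · -- `det_Z g = (det g)·1`
    have h1 := congrArg (fun u : (UnitaryGroup.LocalRing L v)ˣ => (u : UnitaryGroup.LocalRing L v)) (hd g)
    simp only [Matrix.GeneralLinearGroup.val_det_apply] at h1
    rw [MonoidHom.comp_apply, hιval]
    exact congrArg (· • (1 : Matrix (Fin 3) (Fin 3) (UnitaryGroup.LocalRing L v))) h1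
  · -- the per-`ψ` clauses at a continuous `ψ` (the labels are read through `Exists.choose`; both `dite`s reduce by `dif_pos hψ`)
    obtain ⟨hne, hall, hs, hn, hJ1, hJSt⟩ := (hlab ψ hψ).choose_spec.choose_spec
    -- `⟦ℂ_{ψ∘ι∘det}⟧ = π₁`: a constituent (★ C) which is not `πSt` (★ D §1 with ★ C's exponent); stated at the carrier `Gqs L v` of the goal
    have hconst := F0P3cStCharTSStOneDim.isConstituentOf_ofChar_stChar L v (ψ.comp ι) d hd (hopen ψ hψ)
    have hexp := F0P3cStCharTSStOneDim.hasJacquetExponent_ofChar_stChar L v (ψ.comp ι) d hd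
    have hdet1 : (IrrClass.mk (SmoothIrrep.ofChar (ψ.comp (ι.comp d)) (hopen ψ hψ)) : IrrClass (Gqs L v)) = (hlab ψ hψ).choose := by
      rcases (hall _).1 hconst with h | h
      · exact absurd h (F0P3cStCharTSStField.mk_ofChar_ne_of_jacquet_weylStChar L v (ψ.comp ι) _ (hopen ψ hψ) hexp _ hJSt)
      · exact h
    refine ⟨⟨hopen ψ hψ, ?_⟩, ?_, fun c => ?_, ?_, ?_, ?_, ?_⟩
    · simp only [dif_pos hψ]
    · simp only [dif_pos hψ]; rw [hdet1]; exact hne.symm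
    · simp only [dif_pos hψ]; rw [hdet1]; exact hall c
    · simp only [dif_pos hψ]; exact hs
    · simp only [dif_pos hψ]; rw [hdet1]; exact hn
    · simp only [dif_pos hψ]; rw [hdet1]; exact hJ1
    · simp only [dif_pos hψ]; exact hJSt
  · -- the datum corollaries: (ST-L2) and (DET) at `𝔇.stG = stG`, `𝔇.detG = detG`, `𝔇.μGZ = μZ`
    intro H' _ _ _ _ _ _ 𝔇 hst hdet hμ
    refine ⟨fun ψ hψ => ?_, fun ψ hψ => ?_⟩
    · show IrrClass.IsSquareIntegrable 𝔇.μGZ (𝔇.stG ψ)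
      rw [hμ, hst]
      simp only [dif_pos hψ]
      exact (hlab ψ hψ).choose_spec.choose_spec.2.2.1
    · show ¬ IrrClass.IsSquareIntegrable 𝔇.μGZ (𝔇.detG ψ)
      rw [hμ, hdet]
      simp only [dif_pos hψ]
      obtain ⟨hne, hall, hs, hn, hJ1, hJSt⟩ := (hlab ψ hψ).choose_spec.choose_spec
      have hconst := F0P3cStCharTSStOneDim.isConstituentOf_ofChar_stChar L v (ψ.comp ι) d hd (hopen ψ hψ)
      have hexp := F0P3cStCharTSStOneDim.hasJacquetExponent_ofChar_stChar L v (ψ.comp ι) d hd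
      have hdet1 : (IrrClass.mk (SmoothIrrep.ofChar (ψ.comp (ι.comp d)) (hopen ψ hψ)) : IrrClass (Gqs L v)) = (hlab ψ hψ).choose := by
        rcases (hall _).1 hconst with h | h
        · exact absurd h (F0P3cStCharTSStField.mk_ofChar_ne_of_jacquet_weylStChar L v (ψ.comp ι) _ (hopen ψ hψ) hexp _ hJSt)
        · exact h
      rw [hdet1]; exact hn

end Summit.HodgeConjecture.HodgeConjecture.Cruxes.H413.F0P3cStCharTSStPin

end
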